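import Literature.Claims.NS.Liu2025
import Literature.Analysis.FunctionSpaces.MeyersSerrinProofs
import Literature.Analysis.FunctionSpaces.SobolevDomainNormProofs

/-!
# C09 `Liu2025` — kernel refutation of the null-space sentence of the proof of Theorem 4.3 (p.25)

Text of record: Genqian Liu, arXiv:2507.18063 **v3** (42 pp.), typed skeleton `Literature.Claims.NS.Liu2025`
(p465903, commit 0b6628c6bbbf; bib `LiuGenqian2025NSLame`).  Theorem 4.3 (p.22, (4.16): the `λ`-uniform
sup bound for the parabolic inertia Lamé system (4.15)) is proved in step 2 (pp.24–25) from the sentence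
"In view of `(PL)* = L*P* = L*P`, we see that the null-space of the operator `L*P` is just `V⁰`" ⇒ (4.40)
`⟨PL(θ), η⟩ = 0` for all `η ∈ V⁰`, where `L*η = ∂ₜη + µΔη − (u·∇)η − (div u) η` along the local solution
`u` of (4.15) and `P` is the `L²`-projector onto divergence-free fields.

Witness (for EVERY coefficient field `u`, here the zero solution `u ≡ 0` of (4.15) from the datum `ϕ = 0`,
`µ = 1`, `λ = 0`, `m = 2`, `T = 1`): the compactly supported divergence-free test field
`η(t,x) = t · ζ(x)`, `ζ = curl(ψ e₃) = (∂₂ψ, −∂₁ψ, 0)` with `ψ(x) = χ(x) · x₂` (`χ` a smooth bump `≡ 1` near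
`0`), so `ζ(0) = e₁ ≠ 0`; `ζ` is divergence free by the symmetry of `D²ψ` alone.  At `t = 0` every term of
`L*η` except `∂ₜη = ζ` vanishes (`η(0,·) = 0`), so `L*η(0,0) = e₁ ≠ 0`:

* `not_Thm43NullSpace` — the (4.38) reading (test fields with `η(0) = 0`),
  `¬ Literature.Claims.NS.Liu2025.Thm43NullSpace`;
* `not_Thm43NullSpaceV0` — the (4.40) reading "for all `η ∈ V⁰`" (via the skeleton's `thm43NullSpace_of_V0`);
* `not_Thm43NullSpaceAbstract` — the operator-theoretic sentence at the abstract (F15) grain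
  ("`ker (L* ∘ P_V) = V`" for every bounded `L` and closed `V`): `H = ℝ¹`, `V = ⊥`, `L = id` gives
  `ker 0 = ⊤ ≠ ⊥`.

Consequence in the skeleton: (4.40)/(4.41) and hence "`f ≡ 0`" (p.28) are unsupported; the decoupled systems
(4.57)/(4.58) (`Thm43Decoupling`) are refutable only modulo the local solution of (4.15) (`Theorem42`), see the
skeleton's `not_thm43Decoupling_of_not_decouplingExists`.  Axioms: `propext`, `Classical.choice`, `Quot.sound`.
Refuter: ns-claims-refuter-5 (scaffold `LiuScaffold.lean`); filed under interim convention (b) by the paired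
salvage prover.

WHAT THIS IS NOT: not a claim about NS regularity or blow-up; not a claim about any author beyond the typed
locator.
-/

-- The summit's canonical theorem namespace repeats the summit name (single-conjunct summit).
set_option linter.dupNamespace false

noncomputable section

open MeasureTheory TopologicalSpace Set Function Real Filter
open scoped Laplacian InnerProductSpace RealInnerProductSpace ENNReal ContDiff Topology
open Literature.Analysis.FluidPDE Literature.Analysis.FunctionSpaces
open Literature.Claims.NS.Liu2025

namespace Summit.NavierStokesRegularity.NavierStokesRegularity.Theorems.Liu2025

/-! ### The abstract (F15) grain -/

/-- The operator-theoretic sentence "the null-space of `L*P` is just `V⁰`" (p.25) fails for `V = ⊥`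
(`P = 0`, so `ker (L* ∘ P)` is everything) in `ℝ¹`. [cite: LiuGenqian2025NSLame, proof of Thm 4.3 step 2 p.25] -/
theorem not_Thm43NullSpaceAbstract : ¬ Thm43NullSpaceAbstract := by
  intro h
  have h1 := h (EuclideanSpace ℝ (Fin 1)) ⊥ (ContinuousLinearMap.id ℝ _)
  rw [Submodule.starProjection_bot, ContinuousLinearMap.comp_zero] at h1
  have h2 : (EuclideanSpace.single (0 : Fin 1) (1 : ℝ)) ∈
      LinearMap.ker (0 : EuclideanSpace ℝ (Fin 1) →L[ℝ] EuclideanSpace ℝ (Fin 1)).toLinearMap := by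
    simp
  rw [h1, Submodule.mem_bot] at h2
  have h3 := congrArg (fun v : EuclideanSpace ℝ (Fin 1) => v 0) h2
  simp at h3

/-! ### The witness field `ζ = curl(ψ e₃)` -/

/-- Standard basis vector `eᵢ` of `ℝ³`. [folklore] -/
def e (i : Fin 3) : E3 := EuclideanSpace.single i (1 : ℝ)

/-- Coordinates of `eᵢ`. [folklore] -/
@[simp] theorem e_apply (i j : Fin 3) : e i j = if j = i then 1 else 0 := by
  simp [e]

/-- A smooth bump `χ` at the origin, `≡ 1` on the unit ball, supported in the ball of radius `2`. [folklore] -/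
def χ : ContDiffBump (0 : E3) := ⟨1, 2, one_pos, one_lt_two⟩

/-- The coordinate functional `x ↦ x₂` (index `1`). [folklore] -/
def ℓ : E3 →L[ℝ] ℝ := innerSL ℝ (e 1)

/-- The stream function `ψ(x) = χ(x) · x₂`. [folklore] -/
def ψ (x : E3) : ℝ := χ x * ℓ x

/-- `ψ` is smooth. [folklore] -/
theorem ψ_contDiff {n : ℕ∞} : ContDiff ℝ n ψ := χ.contDiff.mul ℓ.contDiff

/-- `ψ` has compact support. [folklore] -/
theorem ψ_hasCompactSupport : HasCompactSupport ψ := χ.hasCompactSupport.mul_right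

/-- Near the origin `ψ = x₂`, so `Dψ(0) = ℓ`. [folklore] -/
theorem fderiv_ψ_zero : fderiv ℝ ψ 0 = ℓ := by
  have h : ψ =ᶠ[𝓝 (0 : E3)] (fun x => ℓ x) := by
    filter_upwards [χ.eventuallyEq_one] with x hx
    simp [ψ, hx]
  rw [h.fderiv_eq, ℓ.fderiv]

/-- The linear map `T ↦ (T e₂) e₁ − (T e₁) e₂` (so that `ζ = A ∘ Dψ = (∂₂ψ, −∂₁ψ, 0)`). [folklore] -/
def A : (E3 →L[ℝ] ℝ) →L[ℝ] E3 :=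
  (ContinuousLinearMap.apply ℝ ℝ (e 1)).smulRight (e 0) -
    (ContinuousLinearMap.apply ℝ ℝ (e 0)).smulRight (e 1)

/-- Unfolding `A`. [folklore] -/
@[simp] theorem A_apply (T : E3 →L[ℝ] ℝ) : A T = (T (e 1)) • e 0 - (T (e 0)) • e 1 := by
  simp [A]

/-- `ζ = curl(ψ e₃) = (∂₂ψ, −∂₁ψ, 0)`. [folklore] -/
def ζ (x : E3) : E3 := A (fderiv ℝ ψ x)

/-- `Dψ` is smooth. [folklore] -/
theorem fderiv_ψ_contDiff {n : ℕ∞} : ContDiff ℝ n (fderiv ℝ ψ) :=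
  (ψ_contDiff (n := n + 1)).fderiv_right (m := n) (by norm_cast)

/-- `ζ` is smooth. [folklore] -/
theorem ζ_contDiff {n : ℕ∞} : ContDiff ℝ n ζ := A.contDiff.comp fderiv_ψ_contDiff

/-- `ζ` has compact support. [folklore] -/
theorem ζ_hasCompactSupport : HasCompactSupport ζ := by
  show HasCompactSupport (A ∘ fderiv ℝ ψ)
  exact (ψ_hasCompactSupport.fderiv (𝕜 := ℝ)).comp_left (map_zero A)

/-- The derivative of `ζ`. [folklore] -/
theorem hasFDerivAt_ζ (x : E3) : HasFDerivAt ζ (A.comp (fderiv ℝ (fderiv ℝ ψ) x)) x :=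
  A.hasFDerivAt.comp x
    (((fderiv_ψ_contDiff (n := 1)).differentiable (by norm_num) x).hasFDerivAt)

/-- Symmetry of `D²ψ`. [folklore] -/
theorem symm_ψ (x : E3) (v w : E3) :
    fderiv ℝ (fderiv ℝ ψ) x v w = fderiv ℝ (fderiv ℝ ψ) x w v :=
  ((ψ_contDiff (n := 2)).contDiffAt.isSymmSndFDerivAt (by simp)) v w

/-- `ζ` is divergence free: `div curl(ψ e₃) = ∂₁∂₂ψ − ∂₂∂₁ψ = 0`. [folklore] -/
theorem ζ_isDivFree : VectorCalculus.IsDivFree ζ := by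
  intro x
  rw [divergence_eq_sum_inner_fderiv (EuclideanSpace.basisFun (Fin 3) ℝ), (hasFDerivAt_ζ x).fderiv]
  have hs := symm_ψ x (e 0) (e 1)
  simp only [Fin.sum_univ_three, EuclideanSpace.basisFun_apply, ContinuousLinearMap.coe_comp,
    Function.comp_apply, A_apply]
  simp only [e, inner_sub_right, inner_smul_right, EuclideanSpace.inner_single_left] at hs ⊢
  simp [Fin.ext_iff] at hs ⊢
  linarith [hs]

/-- `ζ(0) = e₁`. [folklore] -/
theorem ζ_zero : ζ 0 = e 0 := by
  rw [ζ, fderiv_ψ_zero, A_apply]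
  simp [ℓ, e, innerSL_apply_apply, EuclideanSpace.inner_single_left]

/-- `ζ → 0` at infinity (compact support). [folklore] -/
theorem ζ_vanishes : VanishesAtInfinity ζ := ζ_hasCompactSupport.is_zero_at_infty

/-- A smooth compactly supported field lies in every `W^{k,p}(ℝ³)` (classical derivatives are weak
derivatives; Evans §5.2.1). [folklore] -/
theorem memSobolevDomain_of_smooth_compact {f : E3 → E3} (hf : ContDiff ℝ ∞ f)
    (hc : HasCompactSupport f) (k : ℕ) (p : ℝ≥0∞) :
    MemSobolevDomain k p (⊤ : Opens E3) volume f := by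
  induction k generalizing f with
  | zero =>
    rw [memSobolevDomain_zero_iff, Opens.coe_top, Measure.restrict_univ]
    exact hf.continuous.memLp_of_hasCompactSupport hc
  | succ k ih =>
    refine ⟨?_, fderiv ℝ f, MeyersSerrin.hasWeakFDerivOn_of_contDiffOn hf.contDiffOn, fun v => ?_⟩
    · rw [Opens.coe_top, Measure.restrict_univ]
      exact hf.continuous.memLp_of_hasCompactSupport hc
    · exact ih ((hf.fderiv_right (m := ∞) le_rfl).clm_apply contDiff_const) (hc.fderiv_apply ℝ v)

/-! ### The test field `η(t,x) = t · ζ(x)` and the zero solution -/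

/-- The test field `η(t,x) = t · ζ(x)` (so `η(0,·) = 0`). [folklore] -/
def ηw (t : ℝ) (x : E3) : E3 := t • ζ x

/-- `η` is jointly smooth. [folklore] -/
theorem ηw_smooth (S : Set ℝ) : IsSmoothSpaceTimeOn S ηw := by
  have : ContDiff ℝ ∞ (uncurry ηw) := by
    show ContDiff ℝ ∞ (fun p : ℝ × E3 => p.1 • ζ p.2)
    exact contDiff_fst.smul (ζ_contDiff.comp contDiff_snd)
  exact this.contDiffOn

/-- At `t = 0`, within `[0,1]`, `∂ₜη(0,x) = ζ(x)`. [folklore] -/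
theorem timeDerivWithin_ηw_zero (x : E3) : timeDerivWithin (Icc 0 1) ηw 0 x = ζ x := by
  rw [timeDerivWithin_apply]
  have h : HasDerivAt (fun s : ℝ => ηw s x) ((1 : ℝ) • ζ x) 0 := by
    simpa [ηw] using (hasDerivAt_id (0 : ℝ)).smul_const (ζ x)
  rw [h.hasDerivWithinAt.derivWithin (uniqueDiffOn_Icc_zero_one 0 (by simp)), one_smul]

/-- `η(0,·) = 0`. [folklore] -/
theorem ηw_zero : ηw 0 = 0 := by
  funext x; simp [ηw]

/-- The zero field is a Schwartz datum. [folklore] -/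
theorem isSchwartzField_zero : IsSchwartzField (fun _ : E3 => (0 : E3)) :=
  ⟨contDiff_const, fun n K => ⟨0, fun x => by simp⟩⟩

/-- `u ≡ 0` solves (4.15) with datum `ϕ = 0` in the class of Theorem 4.3 (`µ = 1`, `λ = 0`, `m = 2`,
`T = 1`). [cite: LiuGenqian2025NSLame, (4.15) p.22] -/
theorem isLameSolutionOn_zero :
    IsLameSolutionOn 1 1 0 2 (fun _ : E3 => (0 : E3)) (fun _ _ => (0 : E3)) where
  smooth := contDiffOn_const
  sobolev := fun t _ => MemSobolevDomain.zero _ _ _ _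
  vanishing := fun t _ => tendsto_const_nhds
  eqn := fun t _ x => by
    have h1 : Δ (fun _ : E3 => (0 : E3)) = 0 := InnerProductSpace.laplacian_const
    have h2 : (fun y : E3 => VectorCalculus.divergence (fun _ : E3 => (0 : E3)) y) = fun _ => 0 := by
      funext y; simp [VectorCalculus.divergence]
    simp [timeDerivWithin_apply, gradDiv, h1, h2, convect]
  initial := rfl

/-! ### The refutations -/

/-- **The (4.38) reading of the null-space sentence is false**: along the zero solution of (4.15), the
divergence-free test field `η = t · curl(ψ e₃)` with `η(0) = 0` has `L*η(0,0) = ζ(0) = e₁ ≠ 0`.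
[cite: LiuGenqian2025NSLame, proof of Thm 4.3 step 2, (4.38)–(4.40) p.25] -/
theorem not_Thm43NullSpace : ¬ Thm43NullSpace := by
  intro h
  have H := h 1 0 one_pos (by norm_num) 2 le_rfl (fun _ => 0) isSchwartzField_zero 1 one_pos
    (fun _ _ => 0) isLameSolutionOn_zero ηw (ηw_smooth _)
    (fun t _ => by
      show Tendsto (fun x => t • ζ x) _ _
      simpa using ζ_vanishes.const_smul t)
    (fun t _ => (memSobolevDomain_of_smooth_compact ζ_contDiff ζ_hasCompactSupport _ _).const_smul t)
    (fun t _ x => by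
      have hd : HasFDerivAt (ηw t) (t • (A.comp (fderiv ℝ (fderiv ℝ ψ) x))) x :=
        (hasFDerivAt_ζ x).const_smul t
      have h0 := ζ_isDivFree x
      rw [VectorCalculus.divergence, (hasFDerivAt_ζ x).fderiv] at h0
      rw [VectorCalculus.divergence, hd.fderiv, ContinuousLinearMap.toLinearMap_smul, map_smul, h0,
        smul_zero])
    ηw_zero 0 ⟨le_rfl, zero_le_one⟩ 0
  rw [timeDerivWithin_ηw_zero, ηw_zero, ζ_zero] at H
  have h1 : Δ (0 : E3 → E3) = 0 := InnerProductSpace.laplacian_const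
  simp [h1, convect] at H
  have := congrArg (fun v : E3 => v 0) H
  simp at this

/-- **The (4.40) reading "for all `η ∈ V⁰`" is false** (it implies the (4.38) reading,
`thm43NullSpace_of_V0`). [cite: LiuGenqian2025NSLame, proof of Thm 4.3 step 2, (4.40) p.25] -/
theorem not_Thm43NullSpaceV0 : ¬ Thm43NullSpaceV0 := fun h =>
  not_Thm43NullSpace (thm43NullSpace_of_V0 h)

end Summit.NavierStokesRegularity.NavierStokesRegularity.Theorems.Liu2025

end
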